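import Summits.AtomisticToContinuum.Crystallization.Theorems.FrustratedLawDichotomyStrainedPatchBondCalculus

/-!
# Strained patch — FAR SPLIT: the far column (FAR) `FarColumn 𝓘 τ r X` from a PER-HOST finite-dimensional table (charted exterior bonds, un-charted host
# partners and far Hessian columns READ ON THE HOST occupancy / displacement field) plus the UN-CHARTED EXTERIOR TAIL (cluster partners outside the charted ball)
# (decomp-a2c lens-5, generation 73 part 4, sequel of `…StrainedPatchBondCalculus`; crux `AperiodicFrustratedLawGap`, stmt-AtomisticToContinuum-27623; critic row 1206 (R3))

`exteriorForce = extCharted + extUncharted` (partners inside / outside the charted `63/10`-ball); on a `τ`-chart the three charted pieces read on the host: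
`extCharted = hostExt (e a)`, `hostFar = hostFarH (e a)`, `colFar = colFarH (e a)` at `(O, D) = (occ, disp)`.  Hence (FAR) follows from the host table
(HFAR) `HostFarTab 𝓘 τ r Xh` [INSTRUMENTABLE · finite-dimensional per host cell, same reading as HostTop / HostStep] and the tail (XTAIL) `ExtTail 𝓘 τ Xe`
[cluster-quantified; the un-charted partners only — to be bounded by hard-core packing], with `X ≥ Xh + Xe`: `farColumn_of_hostFarTab`, and the record
`coreOff_of_gammaTable_hostFarTab`.  Also: `‖bondForce x‖ = |ljD1 ‖x‖|`, `0 ≤ ljD1 s ≤ s⁻⁷` for `s ≥ 1`, and the termwise bound on the un-charted tail.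
§6: the CLOSED-FORM γ-ENVELOPE `gammaMaj` with `bondGamma_le_gammaMaj` (on `[a, ∞)`), `gammaTable_env` ((γ-TAB) discharged with `L s := gammaMaj (s − m)`),
`bondHessLip_env`, and the records `coreOff_of_envelope_hostFarTab` / `coreOff_of_envelope_hostTables` — no γ-table and no B-table left in the T-leaf record.
No `sorry`, no new axioms, zero edits to landed declarations.
-/

namespace Summit.AtomisticToContinuum.Crystallization.Theorems.FrustratedLawDichotomyStrainedPatchFarSplit

open scoped BigOperators Classical RealInnerProductSpace
open Set
open Summit.AtomisticToContinuum.Crystallization.Theorems.FrustratedLawDichotomyMotifLemmas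
open Summit.AtomisticToContinuum.Crystallization.Theorems.FrustratedLawDichotomyAveragingCut
open Summit.AtomisticToContinuum.Crystallization.Theorems.FrustratedLawDichotomyStrainedPatchHomSplit
open Summit.AtomisticToContinuum.Crystallization.Theorems.FrustratedLawDichotomyStrainedPatchCleanCollar
open Summit.AtomisticToContinuum.Crystallization.Theorems.FrustratedLawDichotomyStrainedPatchPhaseCut
open Summit.AtomisticToContinuum.Crystallization.Theorems.FrustratedLawDichotomyStrainedPatchCoreTube
open Summit.AtomisticToContinuum.Crystallization.Theorems.FrustratedLawDichotomyStrainedPatchStrainBands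
open Summit.AtomisticToContinuum.Crystallization.Theorems.FrustratedLawDichotomyStrainedPatchHomIsometry
open Summit.AtomisticToContinuum.Crystallization.Theorems.FrustratedLawDichotomyStrainedPatchHomTubeIso
open Summit.AtomisticToContinuum.Crystallization.Theorems.FrustratedLawDichotomyStrainedPatchEnvelopeLaw
open Summit.AtomisticToContinuum.Crystallization.Theorems.FrustratedLawDichotomyStrainedPatchEnvelopeTaylor
open Summit.AtomisticToContinuum.Crystallization.Theorems.FrustratedLawDichotomyStrainedPatchChartFamilies
open Summit.AtomisticToContinuum.Crystallization.Theorems.FrustratedLawDichotomyStrainedPatchChartFamiliesPinned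
open Summit.AtomisticToContinuum.Crystallization.Theorems.FrustratedLawDichotomyStrainedPatchQuantSlaving
open Summit.AtomisticToContinuum.Crystallization.Theorems.FrustratedLawDichotomyStrainedPatchHostCells
open Summit.AtomisticToContinuum.Crystallization.Theorems.FrustratedLawDichotomyStrainedPatchForceCap
open Summit.AtomisticToContinuum.Crystallization.Theorems.FrustratedLawDichotomyStrainedPatchTextureFloor
open Summit.AtomisticToContinuum.Crystallization.Theorems.FrustratedLawDichotomyStrainedPatchSVCharge
open Summit.AtomisticToContinuum.Crystallization.Theorems.FrustratedLawDichotomyStrainedPatchChargePrice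
open Summit.AtomisticToContinuum.Crystallization.Theorems.FrustratedLawDichotomyStrainedPatchTaylorTop
open Summit.AtomisticToContinuum.Crystallization.Theorems.FrustratedLawDichotomyStrainedPatchTaylorCharge
open Summit.AtomisticToContinuum.Crystallization.Theorems.FrustratedLawDichotomyStrainedPatchHostStep
open Summit.AtomisticToContinuum.Crystallization.Theorems.FrustratedLawDichotomyStrainedPatchBondCalculus

/-! ## §1. Bond-force magnitudes -/

/-- `‖bondForce x‖ = |V′(‖x‖)| = |ljD1 ‖x‖|` (also at `x = 0`, where both sides vanish). [formal bookkeeping] -/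
theorem norm_bondForce (x : E3) : ‖bondForce x‖ = |ljD1 ‖x‖| := by
  by_cases hx : x = 0
  · subst hx
    simp [bondForce, ljD1]
  · rw [bondForce, norm_smul, Real.norm_eq_abs, abs_div, abs_norm, div_mul_cancel₀ _ (norm_ne_zero_iff.2 hx)]

/-- Beyond the potential well the bond force is attractive and below `s⁻⁷`: for `1 ≤ s`, `0 ≤ ljD1 s ≤ s⁻⁷`. [formal bookkeeping] -/
theorem ljD1_mem_Icc_of_one_le {s : ℝ} (hs : 1 ≤ s) : 0 ≤ ljD1 s ∧ ljD1 s ≤ s⁻¹ ^ 7 := by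
  have h0 : 0 ≤ s⁻¹ := inv_nonneg.2 (by linarith)
  have h1 : s⁻¹ ≤ 1 := inv_le_one_of_one_le₀ hs
  have hle : s⁻¹ ^ 13 ≤ s⁻¹ ^ 7 := pow_le_pow_of_le_one h0 h1 (by norm_num)
  have h13 : 0 ≤ s⁻¹ ^ 13 := pow_nonneg h0 13
  simp only [ljD1]
  constructor <;> linarith

/-- `|ljD1 s| ≤ s⁻⁷` for `1 ≤ s`. [formal bookkeeping] -/
theorem abs_ljD1_le_of_one_le {s : ℝ} (hs : 1 ≤ s) : |ljD1 s| ≤ s⁻¹ ^ 7 := by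
  obtain ⟨h0, h1⟩ := ljD1_mem_Icc_of_one_le hs
  rw [abs_of_nonneg h0]; exact h1

/-! ## §2. The exterior force split: charted partners (inside the `63/10`-ball, host distance `≥ r`) and UN-CHARTED partners (outside the ball) -/

/-- The CHARTED exterior force of row `a`: bond forces from move-test partners inside the charted ball but outside the near set (host distance `≥ r`). -/
noncomputable def extCharted (r : ℝ) {M : ℕ} (z : Fin M → E3) (c : Fin M) {M₀ : ℕ} (z₀ : Fin M₀ → E3) (e : Fin M → Fin M₀) (a : Fin M) : E3 :=
  ∑ k ∈ (moveNbrs 7 z a \ nearSet r z c z₀ e a).filter (fun k => k ∈ ball (63 / 10) z c), bondForce (z k - z a)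

/-- The UN-CHARTED exterior force of row `a`: bond forces from move-test partners OUTSIDE the charted ball (genuinely cluster data). -/
noncomputable def extUncharted {M : ℕ} (z : Fin M → E3) (c a : Fin M) : E3 :=
  ∑ k ∈ (moveNbrs 7 z a).filter (fun k => k ∉ ball (63 / 10) z c), bondForce (z k - z a)

/-- Membership in the charted exterior index set. [formal bookkeeping] -/
theorem mem_extChartedSet {r : ℝ} {M : ℕ} {z : Fin M → E3} {c : Fin M} {M₀ : ℕ} {z₀ : Fin M₀ → E3} {e : Fin M → Fin M₀} {a k : Fin M} :
    k ∈ (moveNbrs 7 z a \ nearSet r z c z₀ e a).filter (fun k => k ∈ ball (63 / 10) z c) ↔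
      k ∈ ball (63 / 10) z c ∧ k ≠ a ∧ dist (z k) (z a) ≤ 7 ∧ ¬dist (z₀ (e k)) (z₀ (e a)) < r := by
  rw [Finset.mem_filter, Finset.mem_sdiff, mem_moveNbrs_iff, mem_nearSet]
  exact ⟨fun ⟨⟨⟨h1, h2⟩, h3⟩, h4⟩ => ⟨h4, h1, h2, fun h5 => h3 ⟨h4, h1, h5⟩⟩, fun ⟨h4, h1, h2, h5⟩ => ⟨⟨⟨h1, h2⟩, fun h => h5 h.2.2⟩, h4⟩⟩

/-- Membership in the un-charted exterior index set. [formal bookkeeping] -/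
theorem mem_extUnchartedSet {M : ℕ} {z : Fin M → E3} {c a k : Fin M} :
    k ∈ (moveNbrs 7 z a).filter (fun k => k ∉ ball (63 / 10) z c) ↔ k ≠ a ∧ dist (z k) (z a) ≤ 7 ∧ k ∉ ball (63 / 10) z c := by
  rw [Finset.mem_filter, mem_moveNbrs_iff, and_assoc]

/-- ★ `exteriorForce = extCharted + extUncharted`. [formal bookkeeping: the near set lies inside the ball] -/
theorem exteriorForce_eq_add (r : ℝ) {M : ℕ} (z : Fin M → E3) (c : Fin M) {M₀ : ℕ} (z₀ : Fin M₀ → E3) (e : Fin M → Fin M₀) (a : Fin M) :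
    exteriorForce r z c z₀ e a = extCharted r z c z₀ e a + extUncharted z c a := by
  rw [exteriorForce, extCharted, extUncharted,
    ← Finset.sum_filter_add_sum_filter_not (moveNbrs 7 z a \ nearSet r z c z₀ e a) (fun k => k ∈ ball (63 / 10) z c)]
  congr 1
  refine Finset.sum_congr ?_ fun _ _ => rfl
  ext k
  rw [Finset.mem_filter, Finset.mem_sdiff, mem_nearSet, mem_extUnchartedSet, mem_moveNbrs_iff]
  exact ⟨fun ⟨⟨⟨h1, h2⟩, _⟩, h4⟩ => ⟨h1, h2, h4⟩, fun ⟨h1, h2, h4⟩ => ⟨⟨⟨h1, h2⟩, fun h => h4 h.1⟩, h4⟩⟩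

/-- The un-charted tail is at most the sum of the bond-force magnitudes `|V′(dist)|`. [formal bookkeeping] -/
theorem norm_extUncharted_le {M : ℕ} (z : Fin M → E3) (c a : Fin M) :
    ‖extUncharted z c a‖ ≤ ∑ k ∈ (moveNbrs 7 z a).filter (fun k => k ∉ ball (63 / 10) z c), |ljD1 (dist (z k) (z a))| :=
  (norm_sum_le _ _).trans (le_of_eq (Finset.sum_congr rfl fun k _ => by rw [norm_bondForce, dist_eq_norm]))

/-- An un-charted partner of row `a` is FAR from `a` when `a` is deep inside the ball: `63/10 − dist (z a) (z c) < dist (z k) (z a)`. [formal bookkeeping] -/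
theorem dist_uncharted_gt {M : ℕ} {z : Fin M → E3} {c a k : Fin M} (hk : k ∉ ball (63 / 10) z c) : 63 / 10 - dist (z a) (z c) < dist (z k) (z a) := by
  have h1 : 63 / 10 < dist (z k) (z c) := not_le.1 fun h => hk (mem_ball.2 h)
  have h2 := dist_triangle (z k) (z a) (z c)
  linarith

/-! ## §3. Host-side far pieces -/

/-- The host CHARTED-EXTERIOR partners of row `h` at reading `(O, D)`: occupied `h' ≠ h` at host distance `≥ r` whose DISPLACED bond is within the move radius `7`. -/
noncomputable def hostExtNbrs (r : ℝ) {M₀ : ℕ} (z₀ : Fin M₀ → E3) (O : Finset (Fin M₀)) (D : Fin M₀ → E3) (h : Fin M₀) : Finset (Fin M₀) :=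
  (O.erase h).filter (fun h' => ¬dist (z₀ h') (z₀ h) < r ∧ ‖(z₀ h' - z₀ h) + (D h' - D h)‖ ≤ 7)

/-- The host CHARTED EXTERIOR FORCE of row `h`: true bond forces of the displaced far bonds (`extCharted` read on the host). -/
noncomputable def hostExt (r : ℝ) {M₀ : ℕ} (z₀ : Fin M₀ → E3) (O : Finset (Fin M₀)) (D : Fin M₀ → E3) (h : Fin M₀) : E3 :=
  ∑ h' ∈ hostExtNbrs r z₀ O D h, bondForce ((z₀ h' - z₀ h) + (D h' - D h))

/-- The host UN-CHARTED-PARTNER model terms of row `h` (`hostFar` read on the host): constant + diagonal terms of the host move-test partners outside the near set. -/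
noncomputable def hostFarH (r : ℝ) {M₀ : ℕ} (z₀ : Fin M₀ → E3) (O : Finset (Fin M₀)) (D : Fin M₀ → E3) (h : Fin M₀) : E3 :=
  ∑ k₀ ∈ moveNbrs 7 z₀ h \ hostNear r z₀ O h, (bondForce (z₀ k₀ - z₀ h) - pairHess (z₀ h - z₀ k₀) (D h))

/-- The host FAR HESSIAN COLUMNS of row `h` (`colFar` read on the host). -/
noncomputable def colFarH (r : ℝ) {M₀ : ℕ} (z₀ : Fin M₀ → E3) (c₀ : Fin M₀) (O : Finset (Fin M₀)) (D : Fin M₀ → E3) (h : Fin M₀) : E3 :=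
  ∑ h' ∈ O.erase h \ hostNear r z₀ O h, hessBlk0 M₀ z₀ c₀ h h' (D h')

/-- ★ **(HFAR) `HostFarTab 𝓘 τ r Xh`** [INSTRUMENTABLE · finite-dimensional per host cell — the per-host part of the census's X₃ column]: on every instance, every
admissible host reading and every maybe-reach row, `‖hostExt‖ + ‖hostFarH‖ + ‖colFarH‖ ≤ Xh(z₀)(h)`. -/
def HostFarTab (𝓘 : ChartFam) (τ r : ℝ) (Xh : SlackTab) : Prop :=
  ∀ (M₀ : ℕ) (z₀ : Fin M₀ → E3) (c₀ : Fin M₀), 𝓘 M₀ z₀ c₀ → ∀ (O : Finset (Fin M₀)) (D : Fin M₀ → E3), HostReading τ z₀ c₀ O D →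
    ∀ h ∈ O, HostMaybeReach τ z₀ c₀ O h → ‖hostExt r z₀ O D h‖ + ‖hostFarH r z₀ O D h‖ + ‖colFarH r z₀ c₀ O D h‖ ≤ Xh M₀ z₀ c₀ h

/-- ★ **(XTAIL) `ExtTail 𝓘 τ Xe`** [cluster-quantified — the un-charted exterior tail; same binders as `FarColumn` / `PricedCharge`]: on every admissible clean
mono-phase `𝓘`-charted cluster, the un-charted exterior force of every reach row is `≤ Xe(z₀)(e a)`. -/
def ExtTail (𝓘 : ChartFam) (τ : ℝ) (Xe : SlackTab) : Prop :=
  ∀ (M : ℕ) (z : Fin M → E3) (c : Fin M) (M₀ : ℕ) (z₀ : Fin M₀ → E3) (c₀ : Fin M₀) (e : Fin M → Fin M₀) (t : ℝ),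
    Admissible M z c → CleanBall (63 / 10) z c → MonoPhaseBall (63 / 10) z c → 0 ≤ t → t ≤ constLaw τ M₀ z₀ c₀ → ChartBy 𝓘 τ t z c z₀ c₀ e →
      FineChart τ z c z₀ c₀ e → ∀ a ∈ ball (63 / 10) z c, IsReach z c a → ‖extUncharted z c a‖ ≤ Xe M₀ z₀ c₀ (e a)

/-! ## §4. The host reading of the charted far pieces -/

section Reading

variable {M : ℕ} {z : Fin M → E3} {c : Fin M} {M₀ : ℕ} {z₀ : Fin M₀ → E3} {c₀ : Fin M₀} {e : Fin M → Fin M₀}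

/-- Membership in the host charted-exterior set. [formal bookkeeping] -/
theorem mem_hostExtNbrs {r : ℝ} {O : Finset (Fin M₀)} {D : Fin M₀ → E3} {h h' : Fin M₀} :
    h' ∈ hostExtNbrs r z₀ O D h ↔ h' ∈ O ∧ h' ≠ h ∧ ¬dist (z₀ h') (z₀ h) < r ∧ ‖(z₀ h' - z₀ h) + (D h' - D h)‖ ≤ 7 := by
  rw [hostExtNbrs, Finset.mem_filter, Finset.mem_erase]
  exact ⟨fun ⟨⟨h1, h2⟩, h3, h4⟩ => ⟨h2, h1, h3, h4⟩, fun ⟨h2, h1, h3, h4⟩ => ⟨⟨h1, h2⟩, h3, h4⟩⟩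

/-- Membership in the host far-column set. [formal bookkeeping] -/
theorem mem_hostColSet {r : ℝ} {O : Finset (Fin M₀)} {h h' : Fin M₀} :
    h' ∈ O.erase h \ hostNear r z₀ O h ↔ h' ∈ O ∧ h' ≠ h ∧ ¬dist (z₀ h') (z₀ h) < r := by
  rw [Finset.mem_sdiff, Finset.mem_erase, hostNear, Finset.mem_filter]
  exact ⟨fun ⟨⟨h1, h2⟩, h3⟩ => ⟨h2, h1, fun h4 => h3 ⟨h2, h1, h4⟩⟩, fun ⟨h2, h1, h3⟩ => ⟨⟨h1, h2⟩, fun h4 => h3 h4.2.2⟩⟩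

/-- Membership in the cluster far-column set. [formal bookkeeping] -/
theorem mem_colFarSet {r : ℝ} {a k : Fin M} :
    k ∈ (ball (63 / 10) z c).erase a \ nearSet r z c z₀ e a ↔ k ∈ ball (63 / 10) z c ∧ k ≠ a ∧ ¬dist (z₀ (e k)) (z₀ (e a)) < r := by
  rw [Finset.mem_sdiff, Finset.mem_erase, mem_nearSet]
  exact ⟨fun ⟨⟨h1, h2⟩, h3⟩ => ⟨h2, h1, fun h4 => h3 ⟨h2, h1, h4⟩⟩, fun ⟨h2, h1, h3⟩ => ⟨⟨h1, h2⟩, fun h4 => h3 h4.2.2⟩⟩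

/-- The displaced host bond of two charted sites is the cluster bond. [formal bookkeeping] -/
theorem hostBond_add_disp_eq (hinj : ∀ b b', b ∈ ball (63 / 10) z c → b' ∈ ball (63 / 10) z c → e b = e b' → b = b') {a k : Fin M}
    (ha : a ∈ ball (63 / 10) z c) (hk : k ∈ ball (63 / 10) z c) :
    (z₀ (e k) - z₀ (e a)) + (disp z c z₀ c₀ e (e k) - disp z c z₀ c₀ e (e a)) = z k - z a := by
  rw [disp_apply hinj hk, disp_apply hinj ha, ← sub_eq_hostBond_add_devDiff z c z₀ c₀ e a k]

/-- The host image of the charted exterior set is the host charted-exterior set. [formal bookkeeping] -/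
theorem image_extChartedSet_eq (r : ℝ) (hinj : ∀ b b', b ∈ ball (63 / 10) z c → b' ∈ ball (63 / 10) z c → e b = e b' → b = b') {a : Fin M}
    (ha : a ∈ ball (63 / 10) z c) :
    ((moveNbrs 7 z a \ nearSet r z c z₀ e a).filter (fun k => k ∈ ball (63 / 10) z c)).image e =
      hostExtNbrs r z₀ (occ z c e) (disp z c z₀ c₀ e) (e a) := by
  ext h'
  rw [Finset.mem_image, mem_hostExtNbrs]
  constructor
  · rintro ⟨k, hk, rfl⟩
    obtain ⟨hkB, hka, hd7, hnr⟩ := mem_extChartedSet.1 hk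
    refine ⟨mem_occ_of_mem hkB, fun hE => hka (hinj k a hkB ha hE), hnr, ?_⟩
    rw [hostBond_add_disp_eq hinj ha hkB, ← dist_eq_norm]
    exact hd7
  · rintro ⟨hO, hne, hnr, hd7⟩
    obtain ⟨k, hkB, rfl⟩ := mem_occ.1 hO
    rw [hostBond_add_disp_eq hinj ha hkB, ← dist_eq_norm] at hd7
    exact ⟨k, mem_extChartedSet.2 ⟨hkB, fun hka => hne (by rw [hka]), hd7, hnr⟩, rfl⟩

/-- ★ The CHARTED EXTERIOR FORCE reads on the host: `extCharted … a = hostExt r z₀ O D (e a)`. [formal bookkeeping] -/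
theorem extCharted_eq_hostExt (r : ℝ) (hinj : ∀ b b', b ∈ ball (63 / 10) z c → b' ∈ ball (63 / 10) z c → e b = e b' → b = b') {a : Fin M}
    (ha : a ∈ ball (63 / 10) z c) : extCharted r z c z₀ e a = hostExt r z₀ (occ z c e) (disp z c z₀ c₀ e) (e a) := by
  have hinjS : Set.InjOn e ↑((moveNbrs 7 z a \ nearSet r z c z₀ e a).filter (fun k => k ∈ ball (63 / 10) z c)) := fun b hb b' hb' hE =>
    hinj b b' (mem_extChartedSet.1 (Finset.mem_coe.1 hb)).1 (mem_extChartedSet.1 (Finset.mem_coe.1 hb')).1 hE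
  rw [hostExt, ← image_extChartedSet_eq r hinj ha, Finset.sum_image hinjS, extCharted]
  exact Finset.sum_congr rfl fun k hk => by rw [hostBond_add_disp_eq hinj ha (mem_extChartedSet.1 hk).1]

/-- ★ The UN-CHARTED HOST PART reads on the host: `hostFar … a = hostFarH r z₀ O D (e a)`. [formal bookkeeping] -/
theorem hostFar_eq_hostFarH (r : ℝ) (hinj : ∀ b b', b ∈ ball (63 / 10) z c → b' ∈ ball (63 / 10) z c → e b = e b' → b = b') {a : Fin M}
    (ha : a ∈ ball (63 / 10) z c) : hostFar r z c z₀ c₀ e a = hostFarH r z₀ (occ z c e) (disp z c z₀ c₀ e) (e a) := by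
  rw [hostFarH, disp_apply hinj ha, ← image_nearSet_eq r hinj ha]
  rfl

/-- The host image of the cluster far-column set is the host far-column set. [formal bookkeeping] -/
theorem image_colFarSet_eq (r : ℝ) (hinj : ∀ b b', b ∈ ball (63 / 10) z c → b' ∈ ball (63 / 10) z c → e b = e b' → b = b') {a : Fin M}
    (ha : a ∈ ball (63 / 10) z c) :
    ((ball (63 / 10) z c).erase a \ nearSet r z c z₀ e a).image e = (occ z c e).erase (e a) \ hostNear r z₀ (occ z c e) (e a) := by
  ext h'
  rw [Finset.mem_image, mem_hostColSet]
  constructor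
  · rintro ⟨k, hk, rfl⟩
    obtain ⟨hkB, hka, hnr⟩ := mem_colFarSet.1 hk
    exact ⟨mem_occ_of_mem hkB, fun hE => hka (hinj k a hkB ha hE), hnr⟩
  · rintro ⟨hO, hne, hnr⟩
    obtain ⟨k, hkB, rfl⟩ := mem_occ.1 hO
    exact ⟨k, mem_colFarSet.2 ⟨hkB, fun hka => hne (by rw [hka]), hnr⟩, rfl⟩

/-- ★ The FAR HESSIAN COLUMNS read on the host: `colFar … a = colFarH r z₀ c₀ O D (e a)`. [formal bookkeeping] -/
theorem colFar_eq_colFarH (r : ℝ) (hinj : ∀ b b', b ∈ ball (63 / 10) z c → b' ∈ ball (63 / 10) z c → e b = e b' → b = b') {a : Fin M}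
    (ha : a ∈ ball (63 / 10) z c) : colFar r z c z₀ c₀ e a = colFarH r z₀ c₀ (occ z c e) (disp z c z₀ c₀ e) (e a) := by
  have hinjS : Set.InjOn e ↑((ball (63 / 10) z c).erase a \ nearSet r z c z₀ e a) := fun b hb b' hb' hE =>
    hinj b b' (mem_colFarSet.1 (Finset.mem_coe.1 hb)).1 (mem_colFarSet.1 (Finset.mem_coe.1 hb')).1 hE
  rw [colFarH, ← image_colFarSet_eq r hinj ha, Finset.sum_image hinjS, colFar]
  exact Finset.sum_congr rfl fun k hk => by rw [disp_apply hinj (mem_colFarSet.1 hk).1]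

end Reading

/-! ## §5. SOUNDNESS: (HFAR) + (XTAIL) ⟹ (FAR); the record -/

/-- `FarColumn` is monotone in the slack column. [formal bookkeeping] -/
theorem farColumn_mono {𝓘 : ChartFam} {τ r : ℝ} {X Y : SlackTab} (hXY : ∀ (M₀ : ℕ) (z₀ : Fin M₀ → E3) (c₀ h : Fin M₀), X M₀ z₀ c₀ h ≤ Y M₀ z₀ c₀ h)
    (hX : FarColumn 𝓘 τ r X) : FarColumn 𝓘 τ r Y :=
  fun M z c M₀ z₀ c₀ e t hz hcl hm ht htT hch hf a ha hr => (hX M z c M₀ z₀ c₀ e t hz hcl hm ht htT hch hf a ha hr).trans (hXY M₀ z₀ c₀ (e a))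

/-- ★★★ **`farColumn_of_hostFarTab`** — (HFAR Xh) ∧ (XTAIL Xe) ∧ `r + 2τ ≤ 7` ⟹ `FarColumn 𝓘 τ r (Xh + Xe)`: the far residual of a reach row is the charted
exterior + un-charted exterior − host far terms − far columns (`farResid_eq`), the charted pieces read on the host at `(occ, disp)`, which is an admissible host
reading with `e a` a maybe-reach row. [formal bookkeeping over §2–§4 and part 1's `farColumn_of_pieces`] -/
theorem farColumn_of_hostFarTab {𝓘 : ChartFam} {τ r : ℝ} {Xh Xe : SlackTab} (hr : r + 2 * τ ≤ 7) (hτ : 0 ≤ τ) (hH : HostFarTab 𝓘 τ r Xh)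
    (hE : ExtTail 𝓘 τ Xe) : FarColumn 𝓘 τ r (fun M₀ z₀ c₀ h => Xh M₀ z₀ c₀ h + Xe M₀ z₀ c₀ h) := by
  refine farColumn_of_pieces hr hτ fun M z c M₀ z₀ c₀ e t hz hcl hm ht htT hch hf a ha hrch => ?_
  have hinj : ∀ b b', b ∈ ball (63 / 10) z c → b' ∈ ball (63 / 10) z c → e b = e b' → b = b' := fun b b' hb hb' hE =>
    hch.2.2.2.2.1 b b' (mem_ball.1 hb) (mem_ball.1 hb') hE
  have h1 := hH M₀ z₀ c₀ hch.1 _ _ (hostReading_of_chart hch hf) (e a) (mem_occ_of_mem ha) (hostMaybeReach_of_isReach hf ha hrch)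
  have h2 := hE M z c M₀ z₀ c₀ e t hz hcl hm ht htT hch hf a ha hrch
  rw [← extCharted_eq_hostExt r hinj ha, ← hostFar_eq_hostFarH r hinj ha, ← colFar_eq_colFarH r hinj ha] at h1
  rw [exteriorForce_eq_add]
  calc ‖extCharted r z c z₀ e a + extUncharted z c a‖ + ‖hostFar r z c z₀ c₀ e a‖ + ‖colFar r z c z₀ c₀ e a‖
      ≤ (‖extCharted r z c z₀ e a‖ + ‖extUncharted z c a‖) + ‖hostFar r z c z₀ c₀ e a‖ + ‖colFar r z c z₀ c₀ e a‖ := by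
        gcongr; exact norm_add_le _ _
    _ ≤ Xh M₀ z₀ c₀ (e a) + Xe M₀ z₀ c₀ (e a) := by linarith

/-- ★★★ **THE T-LEAF RECORD WITH THE FAR SPLIT** — `[CORE-FAR]` from: the cover, `2τ < s₀`, the scalar γ-table, host separation, `r + 2τ ≤ 7`, the PER-HOST far
table (HFAR), the un-charted tail (XTAIL), a slack column `X ≥ Xh + Xe`, the host top, the host steps and the terminal certificate.  After this record the
only cluster-quantified analytic binder left is (XTAIL) (hard-core packing of the un-charted partners); everything else is per-bond, per-host or a certificate.
[formal bookkeeping: part 3's record + `farColumn_of_hostFarTab` + `farColumn_mono`] -/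
theorem coreOff_of_gammaTable_hostFarTab {𝓘 : ChartFam} {τ s₀ r : ℝ} {L : ℝ → ℝ} {X Xh Xe : SlackTab} (k : ℕ → ℝ) (n : ℕ) (hτ : 0 ≤ τ)
    (hcov : FamilyCover 𝓘 (24 / 5) (1 / 100) (1 / 8) τ) (hτs : 2 * τ < s₀)
    (hL : ∀ s : ℝ, s₀ ≤ s → s < r → ∀ s' : ℝ, |s' - s| ≤ 2 * τ → bondGamma s' ≤ L s) (hsep : HostSep 𝓘 s₀) (hr7 : r + 2 * τ ≤ 7)
    (hH : HostFarTab 𝓘 τ r Xh) (hE : ExtTail 𝓘 τ Xe) (hdom : ∀ (M₀ : ℕ) (z₀ : Fin M₀ → E3) (c₀ h : Fin M₀), Xh M₀ z₀ c₀ h + Xe M₀ z₀ c₀ h ≤ X M₀ z₀ c₀ h)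
    (h0 : HostTop 𝓘 τ bondD3 (cubicTail L) r (k 0 * sigmaOne))
    (hs : ∀ i : ℕ, i < n → HostStep 𝓘 τ sigmaOne bondD3 (cubicTail L) r hessBlk0 force0 X (k i) (k (i + 1) * sigmaOne))
    (hcert : SlackCert 𝓘 τ (k n) sigmaOne hessBlk0 force0 X) : CoreOffTubeFloor (63 / 10) (63 / 10) (24 / 5) (1 / 100) 0 :=
  coreOff_of_gammaTable_hostTables k n hτ hcov hτs hL hsep (farColumn_mono hdom (farColumn_of_hostFarTab hr7 hτ hH hE)) h0 hs hcert

/-! ## §6. The CLOSED-FORM γ-ENVELOPE: (γ-TAB) discharged with `L s := gammaMaj (s − m)` (no census table needed) -/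

/-- The γ-MAJORANT `gammaMaj a = max(4032a⁻¹⁶, 960a⁻¹⁰) + 6·max(224a⁻¹⁶, 80a⁻¹⁰) + 3·max(14a⁻¹⁶, 8a⁻¹⁰)`: an antitone closed-form bound of `bondGamma` on `[a, ∞)`
(termwise `|x − y| ≤ max x y` on the three Laurent pairs of `bondGamma r = |4032r⁻¹⁶ − 960r⁻¹⁰| + 6|224r⁻¹⁶ − 80r⁻¹⁰| + 3|14r⁻¹⁶ − 8r⁻¹⁰|`; ≈ +25 % over the
exact band maximum at the nearest-neighbour shell, negligible in the cubic tail elsewhere). -/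
noncomputable def gammaMaj (a : ℝ) : ℝ :=
  max (4032 * a⁻¹ ^ 16) (960 * a⁻¹ ^ 10) + 6 * max (224 * a⁻¹ ^ 16) (80 * a⁻¹ ^ 10) + 3 * max (14 * a⁻¹ ^ 16) (8 * a⁻¹ ^ 10)

/-- `r⁻¹ⁿ⁺ᵏ · rᵏ = r⁻¹ⁿ` for `r ≠ 0`. [formal bookkeeping] -/
theorem inv_pow_add_mul_pow {r : ℝ} (hr : r ≠ 0) (n k : ℕ) : r⁻¹ ^ (n + k) * r ^ k = r⁻¹ ^ n := by
  rw [pow_add, mul_assoc, ← mul_pow, inv_mul_cancel₀ hr, one_pow, mul_one]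

/-- `bondGamma` in the two variables `u = r⁻¹⁶`, `v = r⁻¹⁰` (for `0 < r`). [formal bookkeeping] -/
theorem bondGamma_eq {r : ℝ} (hr : 0 < r) :
    bondGamma r = |4032 * r⁻¹ ^ 16 - 960 * r⁻¹ ^ 10| + 6 * |224 * r⁻¹ ^ 16 - 80 * r⁻¹ ^ 10| + 3 * |14 * r⁻¹ ^ 16 - 8 * r⁻¹ ^ 10| := by
  have hr0 : r ≠ 0 := hr.ne'
  have e19 : r⁻¹ ^ 19 * r ^ 3 = r⁻¹ ^ 16 := inv_pow_add_mul_pow hr0 16 3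
  have e13 : r⁻¹ ^ 13 * r ^ 3 = r⁻¹ ^ 10 := inv_pow_add_mul_pow hr0 10 3
  have e18 : r⁻¹ ^ 18 * r ^ 2 = r⁻¹ ^ 16 := inv_pow_add_mul_pow hr0 16 2
  have e12 : r⁻¹ ^ 12 * r ^ 2 = r⁻¹ ^ 10 := inv_pow_add_mul_pow hr0 10 2
  have e17 : r⁻¹ ^ 17 * r ^ 1 = r⁻¹ ^ 16 := inv_pow_add_mul_pow hr0 16 1
  have e11 : r⁻¹ ^ 11 * r ^ 1 = r⁻¹ ^ 10 := inv_pow_add_mul_pow hr0 10 1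
  rw [pow_one] at e17 e11
  have k1 : bondChiD r * r ^ 3 = 4032 * r⁻¹ ^ 16 - 960 * r⁻¹ ^ 10 := by
    rw [bondChiD]; linear_combination 4032 * e19 - 960 * e13
  have k2 : bondChi r * r ^ 2 = -(224 * r⁻¹ ^ 16 - 80 * r⁻¹ ^ 10) := by
    rw [bondChi]; linear_combination (-224) * e18 + 80 * e12
  have k3 : bondPsiD r * r = -(224 * r⁻¹ ^ 16 - 80 * r⁻¹ ^ 10) := by
    rw [bondPsiD]; linear_combination (-224) * e17 + 80 * e11
  have h1 : |bondChiD r| * r ^ 3 = |4032 * r⁻¹ ^ 16 - 960 * r⁻¹ ^ 10| := by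
    calc |bondChiD r| * r ^ 3 = |bondChiD r| * |r ^ 3| := by rw [abs_of_pos (pow_pos hr 3)]
      _ = |bondChiD r * r ^ 3| := (abs_mul _ _).symm
      _ = _ := by rw [k1]
  have h2 : |bondChi r| * r ^ 2 = |224 * r⁻¹ ^ 16 - 80 * r⁻¹ ^ 10| := by
    calc |bondChi r| * r ^ 2 = |bondChi r| * |r ^ 2| := by rw [abs_of_pos (pow_pos hr 2)]
      _ = |bondChi r * r ^ 2| := (abs_mul _ _).symm
      _ = _ := by rw [k2, abs_neg]
  have h3 : |bondPsiD r| * r = |224 * r⁻¹ ^ 16 - 80 * r⁻¹ ^ 10| := by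
    calc |bondPsiD r| * r = |bondPsiD r| * |r| := by rw [abs_of_pos hr]
      _ = |bondPsiD r * r| := (abs_mul _ _).symm
      _ = _ := by rw [k3, abs_neg]
  rw [bondGamma, bondPsi]
  linear_combination h1 + 3 * h2 + 3 * h3

/-- `|x − y| ≤ max x y` for `0 ≤ x, y`. [formal bookkeeping] -/
private theorem abs_sub_le_max_of_nonneg {x y : ℝ} (hx : 0 ≤ x) (hy : 0 ≤ y) : |x - y| ≤ max x y := by
  rw [abs_le]
  constructor
  · linarith [le_max_right x y]
  · linarith [le_max_left x y]

/-- ★ **`bondGamma ≤ gammaMaj a` on `[a, ∞)`** (`0 < a`). [formal bookkeeping: termwise `|x − y| ≤ max x y` and antitonicity of `r ↦ r⁻¹ⁿ`] -/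
theorem bondGamma_le_gammaMaj {a s : ℝ} (ha : 0 < a) (hs : a ≤ s) : bondGamma s ≤ gammaMaj a := by
  have hs0 : 0 < s := lt_of_lt_of_le ha hs
  have hi : s⁻¹ ≤ a⁻¹ := (inv_le_inv₀ hs0 ha).2 hs
  have hi0 : 0 ≤ s⁻¹ := inv_nonneg.2 hs0.le
  have h16 : s⁻¹ ^ 16 ≤ a⁻¹ ^ 16 := pow_le_pow_left₀ hi0 hi 16
  have h10 : s⁻¹ ^ 10 ≤ a⁻¹ ^ 10 := pow_le_pow_left₀ hi0 hi 10
  have hu : 0 ≤ s⁻¹ ^ 16 := pow_nonneg hi0 16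
  have hv : 0 ≤ s⁻¹ ^ 10 := pow_nonneg hi0 10
  rw [bondGamma_eq hs0, gammaMaj]
  have t1 : |4032 * s⁻¹ ^ 16 - 960 * s⁻¹ ^ 10| ≤ max (4032 * a⁻¹ ^ 16) (960 * a⁻¹ ^ 10) :=
    (abs_sub_le_max_of_nonneg (by positivity) (by positivity)).trans (max_le_max (by nlinarith) (by nlinarith))
  have t2 : |224 * s⁻¹ ^ 16 - 80 * s⁻¹ ^ 10| ≤ max (224 * a⁻¹ ^ 16) (80 * a⁻¹ ^ 10) :=
    (abs_sub_le_max_of_nonneg (by positivity) (by positivity)).trans (max_le_max (by nlinarith) (by nlinarith))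
  have t3 : |14 * s⁻¹ ^ 16 - 8 * s⁻¹ ^ 10| ≤ max (14 * a⁻¹ ^ 16) (8 * a⁻¹ ^ 10) :=
    (abs_sub_le_max_of_nonneg (by positivity) (by positivity)).trans (max_le_max (by nlinarith) (by nlinarith))
  linarith

/-- ★★ **THE γ-TABLE DISCHARGED BY THE ENVELOPE** — for `m < s₀` the band hypothesis (γ-TAB) of `bondHessLip_of_gammaTable` holds with the closed form
`L s := gammaMaj (s − m)`. [formal bookkeeping over `bondGamma_le_gammaMaj`] -/
theorem gammaTable_env {s₀ r m : ℝ} (hms : m < s₀) :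
    ∀ s : ℝ, s₀ ≤ s → s < r → ∀ s' : ℝ, |s' - s| ≤ m → bondGamma s' ≤ gammaMaj (s - m) := by
  intro s hs _ s' hs'
  exact bondGamma_le_gammaMaj (by linarith) (by linarith [(abs_le.1 hs').1])

/-- (C2L) with NO table at all: `BondHessLip bondD3 (fun s => gammaMaj (s − m)) s₀ r m` for every `m < s₀`. [formal bookkeeping] -/
theorem bondHessLip_env {s₀ r m : ℝ} (hms : m < s₀) : BondHessLip bondD3 (fun s => gammaMaj (s - m)) s₀ r m :=
  bondHessLip_of_gammaTable hms (gammaTable_env hms)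

/-- ★★★ **THE T-LEAF RECORD WITH THE ENVELOPE AND THE FAR SPLIT** — `[CORE-FAR]` from: the cover, `2τ < s₀`, host separation, `r + 2τ ≤ 7`, the per-host far
table (HFAR), the un-charted tail (XTAIL), a dominating slack column, the host top and host steps with the CLOSED-FORM tail `cubicTail (s ↦ gammaMaj (s − 2τ))`,
and the terminal certificate.  No γ-table, no B-table: the per-bond law is closed-form.  [formal bookkeeping: `coreOff_of_gammaTable_hostFarTab` + `gammaTable_env`] -/
theorem coreOff_of_envelope_hostFarTab {𝓘 : ChartFam} {τ s₀ r : ℝ} {X Xh Xe : SlackTab} (k : ℕ → ℝ) (n : ℕ) (hτ : 0 ≤ τ)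
    (hcov : FamilyCover 𝓘 (24 / 5) (1 / 100) (1 / 8) τ) (hτs : 2 * τ < s₀) (hsep : HostSep 𝓘 s₀) (hr7 : r + 2 * τ ≤ 7)
    (hH : HostFarTab 𝓘 τ r Xh) (hE : ExtTail 𝓘 τ Xe) (hdom : ∀ (M₀ : ℕ) (z₀ : Fin M₀ → E3) (c₀ h : Fin M₀), Xh M₀ z₀ c₀ h + Xe M₀ z₀ c₀ h ≤ X M₀ z₀ c₀ h)
    (h0 : HostTop 𝓘 τ bondD3 (cubicTail fun s => gammaMaj (s - 2 * τ)) r (k 0 * sigmaOne))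
    (hs : ∀ i : ℕ, i < n → HostStep 𝓘 τ sigmaOne bondD3 (cubicTail fun s => gammaMaj (s - 2 * τ)) r hessBlk0 force0 X (k i) (k (i + 1) * sigmaOne))
    (hcert : SlackCert 𝓘 τ (k n) sigmaOne hessBlk0 force0 X) : CoreOffTubeFloor (63 / 10) (63 / 10) (24 / 5) (1 / 100) 0 :=
  coreOff_of_gammaTable_hostFarTab k n hτ hcov hτs (gammaTable_env hτs) hsep hr7 hH hE hdom h0 hs hcert

/-- ★★★ The same record keeping the far column (FAR) whole (for use before the X₃ split is instrumented). [formal bookkeeping] -/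
theorem coreOff_of_envelope_hostTables {𝓘 : ChartFam} {τ s₀ r : ℝ} {X : SlackTab} (k : ℕ → ℝ) (n : ℕ) (hτ : 0 ≤ τ)
    (hcov : FamilyCover 𝓘 (24 / 5) (1 / 100) (1 / 8) τ) (hτs : 2 * τ < s₀) (hsep : HostSep 𝓘 s₀) (hX : FarColumn 𝓘 τ r X)
    (h0 : HostTop 𝓘 τ bondD3 (cubicTail fun s => gammaMaj (s - 2 * τ)) r (k 0 * sigmaOne))
    (hs : ∀ i : ℕ, i < n → HostStep 𝓘 τ sigmaOne bondD3 (cubicTail fun s => gammaMaj (s - 2 * τ)) r hessBlk0 force0 X (k i) (k (i + 1) * sigmaOne))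
    (hcert : SlackCert 𝓘 τ (k n) sigmaOne hessBlk0 force0 X) : CoreOffTubeFloor (63 / 10) (63 / 10) (24 / 5) (1 / 100) 0 :=
  coreOff_of_gammaTable_hostTables k n hτ hcov hτs (gammaTable_env hτs) hsep hX h0 hs hcert

end Summit.AtomisticToContinuum.Crystallization.Theorems.FrustratedLawDichotomyStrainedPatchFarSplit
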